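import Literature.Barriers.PneNP.PerfectMatchingPolytopeNotPsdMinimal
import Literature.Combinatorics.AssociationSchemes.CutMatchingRestriction
import HarnessLib

/-!
# `P_PM(K_n)` is psd-minimal iff `n ≤ 8`: `rk_psd(S_Edmonds(K_n)) ≥ dim P_PM(K_n) + 2` for every even `n ≥ 10`

Companion to `PerfectMatchingPolytopeDimension.lean` §6/§9 (dimension bound `rk_psd ≥ C(n,2) − n + 1 = dim + 1` for all
even `n ≥ 4`, ATTAINED for `n ≤ 8`; "for `n ≥ 10` … open") and to `PerfectMatchingPolytopeNotPsdMinimal.lean` (the base case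
`rk_psd(S_Edmonds(K_10)) ≥ 37`, kernel). This file lifts the base case to every even `n ≥ 10`:

* `lift_step` : if every psd factorisation of `S_Edmonds(K_n)` has size `≥ r` (`n ≥ 4` even), every psd factorisation
  of `S_Edmonds(K_{n+2})` has size `≥ r + (2n − 1)` — and `2n − 1 = dim P_PM(K_{n+2}) − dim P_PM(K_n)`;
* `dim_add_two_le_of_hasPsdFactorization` : for even `n ≥ 10`, `HasPsdFactorization (pmFullSlack n) r → C(n,2) − n + 2 ≤ r`;
* `not_hasPsdFactorization_pmFullSlack_dim` : no psd factorisation of size `C(n,2) − n + 1` (`n ≥ 10` even);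
* `hasPsdFactorization_pmFullSlack_dim_iff` : **for even `n ≥ 4`, `S_Edmonds(K_n)` has a psd factorisation of size
  `dim P_PM(K_n) + 1` iff `n ≤ 8`** — `P_PM(K_n)` is psd-minimal exactly for `K_4, K_6, K_8`.

## The lifting step (GRT Prop. 3.8 "faces of psd-minimal polytopes" made quantitative along an explicit flag)

Label the NEW vertices of `K_{n+2}` by `0, 1` and embed `K_n` on `{2, …, n+1}` (`up` = the tree's `emb` for `V = {0,1}`).
The face `x_{01} = 1` of `P_PM(K_{n+2})` is `P_PM(K_n)`: on lifted rows (odd sets / edges inside `{2,…,n+1}`) and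
lifted matchings `{01} ∪ M⁺` the slack of `K_{n+2}` IS the slack of `K_n` (`pmFullSlack_lift`). The `2n` edge rows
through `0` or `1` vanish on all lifted matchings (`rowT_liftPM`). Among them take the `2n − 1` rows
`{0,n+1}; {1,2}, …, {1,n}; {0,2}, …, {0,n}` (`rowT`) and the `2n − 1` columns
`T(n+1,n); T(3,2), T(2,3), …, T(2,n); T(2,n+1), …, T(n,n+1)` (`colT`, the three-block matchings `T(p,q) = {0p, 1q, p̄q̄} ∪
blocks` of `MatchingSlackPsdFoolingSetSharp`): `T(p,q)` contains exactly the two new-vertex edges `{0,p}`, `{1,q}`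
(`mk_mem_toPMatch_iff`), so this block is TRIANGULAR with non-zero diagonal (`rowT_mem_colT`, `rowT_not_mem_colT`:
the order is chosen so that the second new-vertex edge of each column is a LATER row, the last one `{1,n+1}` being no
row at all). Hence `S_Edmonds(K_{n+2})` contains `[T 0; Q S_Edmonds(K_n)]` and FGPRT Thm. 2.10
(`rank_psd [P 0; Q R] ≥ rank_psd P + rank_psd R`, tree `FawziEtAl2015_thm210_holds`) with the fooling bound
`rank_psd T ≥ 2n − 1` gives the step. Induction from `K_10` (`37 = C(10,2) − 10 + 2`) finishes.

Everything is proved; no named fact; axioms `{propext, Classical.choice, Quot.sound}`; no `decide` on data (the file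
elaborates in ≈ 20 s). presearch: as in the companion file (GRT 2013 §4–5 classify psd-minimal polytopes only in
dimension `≤ 4`; Gouveia–Macchia–Thomas–Wiebe arXiv:1808.01692 via slack ideals; nothing in print on `P_PM(K_n)`); the
cell's MEMO-1 §1.2(b′) stated this theorem with the same face argument (paper-level); here it is kernel-checked.
Honest limits: exactly `+1` over the dimension bound for every `n ≥ 10` (the excess does not grow with `n` by this method);
the equivariant upper bound `1 + n(n−3)/2 + Catalan(n/2)` (LIT-4) is not in the kernel. Label: instrument / exact
structural theorem about the route Target's polytope. WHAT THIS IS NOT: nothing asymptotic beyond `≈ n²/2`, no statement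
about the crux `TracialDecayExp20` (stmt-PneNP-19878, OPEN), no P-vs-NP content.
-/

noncomputable section

open Finset Matrix Equiv

namespace Literature.Barriers.PneNP

open Literature.Combinatorics.Optimization
  (HasPsdFactorization FawziEtAl2015_thm210_holds)
open Literature.Combinatorics.Optimization.PMPolytopeDim (pmVec pmVec_apply pmFullSlack pmFullSlack_inl pmFullSlack_inr
  choose_two_sub_add_one_le_of_hasPsdFactorization hasPsdFactorization_pmFullSlack_of_le_eight)
open PsdMinimalTen (thirtySeven_le_of_hasPsdFactorization_pmFullSlack_ten)
open Literature.Combinatorics.AssociationSchemes.CutMatchingRestriction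
  (crossCount crossCount_image crossCount_union cc_eq_crossCount emb emb_not_mem emb_injective isPMOn_union_image)
open Literature.Combinatorics.AssociationSchemes.HomogeneousMatchingFamilies (edgesOf mem_edgesOf)
open Literature.Combinatorics.SimpleGraph.CycleSpace (Crosses crosses_mk)
open PsdFoolingSet (TriCol triFun pmOddCutSlack_eq_zero_iff)

namespace PsdMinimalIff

variable {n : ℕ}

/-! ### §1 The face `x_{01} = 1` of `P_PM(K_{n+2})`: lifting `K_n` along the two new vertices `0, 1` -/

/-- The two new vertices `0, 1` of `K_{n+2}`. [cite: GouveiaRobinsonThomas2013, Prop. 3.8 (p09)] -/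
def V01 (n : ℕ) : Finset (Fin (n + 2)) := {⟨0, by omega⟩, ⟨1, by omega⟩}

/-- `|V(K_{n+2}) ∖ {0,1}| = n`. [folklore] -/
private theorem card_compl_V01 (n : ℕ) : ((univ : Finset (Fin (n + 2))) \ V01 n).card = n := by
  rw [Finset.card_univ_sdiff, Fintype.card_fin, V01, Finset.card_pair (by simp)]
  omega

/-- The edge `{0,1}` as a one-edge matching. [cite: GouveiaRobinsonThomas2013, Prop. 3.8 (p09)] -/
def S01 (n : ℕ) : Finset (Sym2 (Fin (n + 2))) := {s(⟨0, by omega⟩, ⟨1, by omega⟩)}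

/-- `{01}` is a perfect matching of `{0,1}`. [cite: Rothvoss2017, §1 (PDF p. 4)] -/
private theorem isPMOn_S01 (n : ℕ) : IsPMOn (V01 n) (S01 n) := by
  refine ⟨?_, ?_, ?_⟩
  · intro e he
    rw [S01, Finset.mem_singleton] at he
    subst he
    rw [Finset.mk_mem_sym2_iff, V01]
    simp
  · intro e he
    rw [S01, Finset.mem_singleton] at he
    subst he
    rw [Sym2.mk_isDiag_iff]
    simp
  · intro v hv
    rw [Finset.card_eq_one]
    refine ⟨s(⟨0, by omega⟩, ⟨1, by omega⟩), ?_⟩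
    ext e
    simp only [S01, Finset.mem_filter, Finset.mem_singleton]
    constructor
    · rintro ⟨rfl, -⟩; rfl
    · rintro rfl
      refine ⟨rfl, ?_⟩
      rw [V01, Finset.mem_insert, Finset.mem_singleton] at hv
      rcases hv with rfl | rfl <;> simp

/-- The embedding of the old vertices: `Fin n ↪ Fin (n+2)` onto `{2, …, n+1}` (the tree's `emb`). [cite: KupavskiiZakharov2022, §2 (p. 6)] -/
def up (n : ℕ) : Fin n ↪o Fin (n + 2) := emb (V01 n) (card_compl_V01 n)

/-- Old vertices avoid `{0,1}`. [folklore] -/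
private theorem up_not_mem (i : Fin n) : up n i ∉ V01 n := emb_not_mem _ _ i

/-- **The lifted matching** `M ↦ {01} ∪ M⁺` (a vertex of the face `x_{01} = 1` of `P_PM(K_{n+2})`).
[cite: GouveiaRobinsonThomas2013, Prop. 3.8 (p09)] -/
def liftPM (M : PMatch n) : PMatch (n + 2) :=
  ⟨S01 n ∪ M.1.image (Sym2.map (up n)), (isPMOn_union_image (card_compl_V01 n) (isPMOn_S01 n) M.2).1⟩

/-- The lifted odd set `U ↦ U⁺`. [cite: Rothvoss2017, §2 (PDF p. 5)] -/
def liftOdd (U : OddSet n) : OddSet (n + 2) :=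
  ⟨U.1.image (up n), by rw [card_image_of_injective _ (up n).injective]; exact U.2⟩

/-- The lifted edge `g ↦ g⁺`. [cite: Rothvoss2017, §2 (PDF p. 5)] -/
def liftEdge (g : Edge n) : Edge (n + 2) :=
  ⟨Sym2.map (up n) g.1, by rw [Sym2.isDiag_map (up n).injective]; exact g.2⟩

/-- Lifted rows of the full slack matrix. [cite: FawziEtAl2015, Def. 3.1 (p09)] -/
def liftRow : OddSet n ⊕ Edge n → OddSet (n + 2) ⊕ Edge (n + 2) := Sum.map liftOdd liftEdge

/-- An edge through a new vertex is not an edge of a lifted matching. [cite: GouveiaRobinsonThomas2013, Prop. 3.8 (p09)] -/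
theorem mk_not_mem_liftPM {z c : Fin (n + 2)} (hz : z ∈ V01 n) (hc : c ∉ V01 n) (M : PMatch n) :
    s(z, c) ∉ (liftPM M).1 := by
  intro h
  rcases Finset.mem_union.1 h with h | h
  · rw [S01, Finset.mem_singleton] at h
    apply hc
    have : c ∈ s((⟨0, by omega⟩ : Fin (n + 2)), ⟨1, by omega⟩) := by rw [← h]; exact Sym2.mem_mk_right _ _
    rw [V01, Finset.mem_insert, Finset.mem_singleton]
    rcases Sym2.mem_iff.1 this with h' | h'
    · exact Or.inl h'
    · exact Or.inr h'
  · obtain ⟨g, -, hg⟩ := Finset.mem_image.1 h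
    have hz' : z ∈ Sym2.map (up n) g := by rw [hg]; exact Sym2.mem_mk_left _ _
    obtain ⟨a, -, ha⟩ := Sym2.mem_map.1 hz'
    exact up_not_mem a (ha ▸ hz)

/-- `{01}` does not cross a lifted set. [folklore] -/
private theorem crossCount_liftOdd_S01 (U : OddSet n) : crossCount (liftOdd U).1 (S01 n) = 0 := by
  unfold crossCount
  rw [Finset.card_eq_zero, S01, Finset.filter_singleton, if_neg]
  rw [crosses_mk]
  have h0 : (⟨0, by omega⟩ : Fin (n + 2)) ∉ (liftOdd U).1 := fun h => by
    obtain ⟨a, -, ha⟩ := Finset.mem_image.1 h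
    exact up_not_mem a (by rw [ha, V01]; simp)
  have h1 : (⟨1, by omega⟩ : Fin (n + 2)) ∉ (liftOdd U).1 := fun h => by
    obtain ⟨a, -, ha⟩ := Finset.mem_image.1 h
    exact up_not_mem a (by rw [ha, V01]; simp)
  tauto

/-- `{01}` and a lifted matching are disjoint edge sets. [folklore] -/
private theorem disjoint_S01_image (M : PMatch n) : Disjoint (S01 n) (M.1.image (Sym2.map (up n))) := by
  rw [Finset.disjoint_left]
  intro e he hmem
  rw [S01, Finset.mem_singleton] at he
  subst he
  obtain ⟨g, -, hg⟩ := Finset.mem_image.1 hmem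
  have h0 : (⟨0, by omega⟩ : Fin (n + 2)) ∈ Sym2.map (up n) g := by rw [hg]; exact Sym2.mem_mk_left _ _
  obtain ⟨a, -, ha⟩ := Sym2.mem_map.1 h0
  exact up_not_mem a (by rw [ha, V01]; simp)

/-- **The face block**: on lifted rows and lifted matchings the slack of `K_{n+2}` is the slack of `K_n`.
[cite: GouveiaRobinsonThomas2013, Prop. 3.8 (p09)] -/
theorem pmFullSlack_lift (j : OddSet n ⊕ Edge n) (M : PMatch n) :
    pmFullSlack (n + 2) (liftRow j) (liftPM M) = pmFullSlack n j M := by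
  cases j with
  | inl U =>
    show pmOddCutSlack (n + 2) (liftOdd U) (liftPM M) = pmOddCutSlack n U M
    rw [pmOddCutSlack_apply, pmOddCutSlack_apply, cc_eq_crossCount, cc_eq_crossCount]
    congr 2
    show crossCount (U.1.image (up n)) (S01 n ∪ M.1.image (Sym2.map (up n))) = crossCount U.1 M.1
    rw [crossCount_union (disjoint_S01_image M), show U.1.image (up n) = (liftOdd U).1 from rfl,
      crossCount_liftOdd_S01, zero_add]
    exact crossCount_image (up n).injective U.1 M.1
  | inr g =>
    show pmVec (n + 2) (liftPM M) (liftEdge g) = pmVec n M g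
    rw [pmVec_apply, pmVec_apply]
    have : (liftEdge g).1 ∈ (liftPM M).1 ↔ g.1 ∈ M.1 := by
      show Sym2.map (up n) g.1 ∈ S01 n ∪ M.1.image (Sym2.map (up n)) ↔ g.1 ∈ M.1
      rw [Finset.mem_union, (Sym2.map.injective (up n).injective).mem_finset_image]
      constructor
      · rintro (h | h)
        · exfalso
          exact Finset.disjoint_left.1 (disjoint_S01_image M) h (Finset.mem_image_of_mem _ (by
            -- any edge of `M` works: but we need `g.1 ∈ M.1`; instead derive a contradiction directly
            exact absurd h (fun h' => by
              rw [S01, Finset.mem_singleton] at h'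
              have h0 : (⟨0, by omega⟩ : Fin (n + 2)) ∈ Sym2.map (up n) g.1 := by
                rw [h']; exact Sym2.mem_mk_left _ _
              obtain ⟨a, -, ha⟩ := Sym2.mem_map.1 h0
              exact up_not_mem a (by rw [ha, V01]; simp))))
        · exact h
      · exact fun h => Or.inr h
    simp only [this]

/-- Rows through a new vertex vanish on the face block. [cite: GouveiaRobinsonThomas2013, Prop. 3.8 (p09)] -/
theorem pmFullSlack_inr_liftPM_eq_zero {z c : Fin (n + 2)} (hz : z ∈ V01 n) (hc : c ∉ V01 n)
    (hzc : ¬ (s(z, c)).IsDiag) (M : PMatch n) :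
    pmFullSlack (n + 2) (Sum.inr ⟨s(z, c), hzc⟩) (liftPM M) = 0 := by
  rw [pmFullSlack_inr, pmVec_apply, if_neg]
  exact mk_not_mem_liftPM hz hc M

/-! ### §2 The triangular block: `2n − 1` edges through the new vertices and `2n − 1` columns `T(p,q)` -/

/-- Values of the partner map of `T(p,q)` at the new vertices `0, 1` and on old labels `≥ 2`. [folklore] -/
private theorem triFun_facts (t : TriCol (n + 2)) (x : ℕ) :
    (x = 0 → triFun t.p t.p' t.q t.q' x = t.p) ∧ (x = 1 → triFun t.p t.p' t.q t.q' x = t.q) ∧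
      (2 ≤ x → ((triFun t.p t.p' t.q t.q' x = 0 ↔ x = t.p) ∧ (triFun t.p t.p' t.q t.q' x = 1 ↔ x = t.q))) := by
  obtain ⟨h1, h2, h3, h4, h5, h6, h7, h8⟩ := t.ok
  generalize hv : triFun t.p t.p' t.q t.q' x = v
  unfold triFun at hv
  split_ifs at hv <;> omega

/-- **Which edges through a new vertex a column `T(p,q)` contains**: exactly `{0, p}` and `{1, q}`.
[cite: Rothvoss2017, §2 (PDF p. 6)] -/
theorem mk_mem_toPMatch_iff (t : TriCol (n + 2)) (z c : Fin (n + 2)) (hz : z.val ≤ 1) (hc : 2 ≤ c.val) :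
    s(z, c) ∈ t.toPMatch.1 ↔ (z.val = 0 ∧ c.val = t.p) ∨ (z.val = 1 ∧ c.val = t.q) := by
  have hperm : ∀ x : Fin (n + 2), (t.perm x).val = triFun t.p t.p' t.q t.q' x.val := fun x => rfl
  show s(z, c) ∈ edgesOf t.perm ↔ _
  rw [mem_edgesOf]
  constructor
  · rintro ⟨x, hx⟩
    rcases Sym2.eq_iff.1 hx with ⟨rfl, h⟩ | ⟨rfl, h⟩
    · have hv := congrArg Fin.val h
      rw [hperm] at hv
      obtain ⟨f0, f1, -⟩ := triFun_facts t x.val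
      rcases Nat.le_one_iff_eq_zero_or_eq_one.1 hz with h0 | h0
      · exact Or.inl ⟨h0, by rw [← hv, f0 h0]⟩
      · exact Or.inr ⟨h0, by rw [← hv, f1 h0]⟩
    · have hv := congrArg Fin.val h
      rw [hperm] at hv
      obtain ⟨-, -, f2⟩ := triFun_facts t x.val
      obtain ⟨g0, g1⟩ := f2 hc
      rcases Nat.le_one_iff_eq_zero_or_eq_one.1 hz with h0 | h0
      · exact Or.inl ⟨h0, (g0.1 (by omega))⟩
      · exact Or.inr ⟨h0, (g1.1 (by omega))⟩
  · rintro (⟨h0, h⟩ | ⟨h0, h⟩)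
    · refine ⟨z, ?_⟩
      congr 1
      apply Fin.ext
      rw [hperm, (triFun_facts t z.val).1 h0, h]
    · refine ⟨z, ?_⟩
      congr 1
      apply Fin.ext
      rw [hperm, (triFun_facts t z.val).2.1 h0, h]

/-- New-vertex label of the `b`-th row of the triangular block. [folklore] -/
def zOf (n : ℕ) (b : ℕ) : ℕ := if b = 0 then 0 else if b ≤ n - 1 then 1 else 0

/-- Old-vertex label of the `b`-th row of the triangular block. [folklore] -/
def cOf (n : ℕ) (b : ℕ) : ℕ := if b = 0 then n + 1 else if b ≤ n - 1 then b + 1 else b + 2 - n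

/-- The label matched to `0` in the `b`-th column of the triangular block. [folklore] -/
def pOf (n : ℕ) (b : ℕ) : ℕ :=
  if b = 0 then n + 1 else if b ≤ n - 1 then (if b + 1 = n then 2 else b + 2 - 2 * ((b + 1) % 2)) else b + 2 - n

/-- The label matched to `1` in the `b`-th column of the triangular block. [folklore] -/
def qOf (n : ℕ) (b : ℕ) : ℕ := if b = 0 then n else if b ≤ n - 1 then b + 1 else n + 1

/-- The four shapes of an index of the triangular block, with the values of `zOf, cOf, pOf, qOf`. [folklore] -/
private theorem shape_of_lt {b : ℕ} (hn : 4 ≤ n) (_hb : b < 2 * n - 1) :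
    (b = 0 ∧ zOf n b = 0 ∧ cOf n b = n + 1 ∧ pOf n b = n + 1 ∧ qOf n b = n) ∨
    (1 ≤ b ∧ b + 1 < n ∧ zOf n b = 1 ∧ cOf n b = b + 1 ∧ pOf n b = b + 2 - 2 * ((b + 1) % 2) ∧ qOf n b = b + 1) ∨
    (b + 1 = n ∧ zOf n b = 1 ∧ cOf n b = n ∧ pOf n b = 2 ∧ qOf n b = n) ∨
    (n ≤ b ∧ zOf n b = 0 ∧ cOf n b = b + 2 - n ∧ pOf n b = b + 2 - n ∧ qOf n b = n + 1) := by
  generalize hz : zOf n b = z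
  generalize hc : cOf n b = c
  generalize hp : pOf n b = p
  generalize hq : qOf n b = q
  unfold zOf at hz
  unfold cOf at hc
  unfold pOf at hp
  unfold qOf at hq
  split_ifs at hz hc hp hq <;> omega

/-- Bounds: `zOf ≤ 1 < 2 ≤ cOf < n + 2`. [folklore] -/
private theorem zOf_cOf_bounds {b : ℕ} (hn : 4 ≤ n) (hb : b < 2 * n - 1) :
    zOf n b ≤ 1 ∧ 2 ≤ cOf n b ∧ cOf n b < n + 2 := by
  rcases shape_of_lt hn hb with h | h | h | h <;> omega

/-- **The rows of the triangular block**: the edges `{0, n+1}`; `{1, c}` (`c = 2, …, n`); `{0, c}` (`c = 2, …, n`) — all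
but one (`{1, n+1}`) of the `2n` edges through a new vertex. [cite: GouveiaRobinsonThomas2013, Prop. 3.8 (p09)] -/
def rowT (hn : 4 ≤ n) (b : Fin (2 * n - 1)) : Edge (n + 2) :=
  ⟨s(⟨zOf n b.val, by have := zOf_cOf_bounds hn b.2; omega⟩, ⟨cOf n b.val, (zOf_cOf_bounds hn b.2).2.2⟩), by
    rw [Sym2.mk_isDiag_iff, Fin.mk.injEq]
    have := zOf_cOf_bounds hn b.2
    omega⟩

/-- **The columns of the triangular block**: `T(n+1, n)`; `T(c̄, c)` (`c = 2, …, n−1`), `T(2, n)`; `T(c, n+1)`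
(`c = 2, …, n`). [cite: Rothvoss2017, §2 (PDF p. 6)] -/
def colT (hn : 4 ≤ n) (he : Even n) (b : Fin (2 * n - 1)) : TriCol (n + 2) :=
  ⟨pOf n b.val, pOf n b.val + 1 - 2 * (pOf n b.val % 2), qOf n b.val, qOf n b.val + 1 - 2 * (qOf n b.val % 2), by
    obtain ⟨m, hm⟩ := he
    rcases shape_of_lt hn b.2 with ⟨h1, -, -, h3, h4⟩ | ⟨h1, h2, -, -, h3, h4⟩ | ⟨h1, -, -, h3, h4⟩ | ⟨h1, -, -, h3, h4⟩ <;>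
      rw [h3, h4] <;> omega⟩

/-- The diagonal of the block: the `b`-th row edge lies in the `b`-th column. [cite: GouveiaRobinsonThomas2013, Prop. 3.8 (p09)] -/
theorem rowT_mem_colT (hn : 4 ≤ n) (he : Even n) (b : Fin (2 * n - 1)) :
    (rowT hn b).1 ∈ (colT hn he b).toPMatch.1 := by
  have hbds := zOf_cOf_bounds hn b.2
  rw [rowT, mk_mem_toPMatch_iff (colT hn he b) _ _ hbds.1 hbds.2.1]
  show (zOf n b.val = 0 ∧ cOf n b.val = pOf n b.val) ∨ (zOf n b.val = 1 ∧ cOf n b.val = qOf n b.val)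
  rcases shape_of_lt hn b.2 with h | h | h | h <;> omega

/-- Above the diagonal the block vanishes: an EARLIER row edge is not in a later column.
[cite: GouveiaRobinsonThomas2013, Prop. 3.8 (p09)] -/
theorem rowT_not_mem_colT (hn : 4 ≤ n) (he : Even n) {a b : Fin (2 * n - 1)} (hab : a < b) :
    (rowT hn a).1 ∉ (colT hn he b).toPMatch.1 := by
  have hab' : a.val < b.val := hab
  have hbds := zOf_cOf_bounds hn a.2
  obtain ⟨m, hm⟩ := id he
  rw [rowT, mk_mem_toPMatch_iff (colT hn he b) _ _ hbds.1 hbds.2.1]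
  show ¬ ((zOf n a.val = 0 ∧ cOf n a.val = pOf n b.val) ∨ (zOf n a.val = 1 ∧ cOf n a.val = qOf n b.val))
  rcases shape_of_lt hn a.2 with h | h | h | h <;> rcases shape_of_lt hn b.2 with h' | h' | h' | h' <;> omega

/-- The rows of the block pass through a new vertex and an old one. [folklore] -/
private theorem rowT_ends (hn : 4 ≤ n) (b : Fin (2 * n - 1)) :
    (⟨zOf n b.val, by have := zOf_cOf_bounds hn b.2; omega⟩ : Fin (n + 2)) ∈ V01 n ∧
      (⟨cOf n b.val, (zOf_cOf_bounds hn b.2).2.2⟩ : Fin (n + 2)) ∉ V01 n := by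
  have := zOf_cOf_bounds hn b.2
  constructor
  · rw [V01, Finset.mem_insert, Finset.mem_singleton]
    simp only [Fin.mk.injEq]
    omega
  · rw [V01, Finset.mem_insert, Finset.mem_singleton]
    simp only [Fin.mk.injEq]
    omega

/-- The rows of the triangular block vanish on the face block. [cite: GouveiaRobinsonThomas2013, Prop. 3.8 (p09)] -/
theorem rowT_liftPM (hn : 4 ≤ n) (a : Fin (2 * n - 1)) (M : PMatch n) :
    pmFullSlack (n + 2) (Sum.inr (rowT hn a)) (liftPM M) = 0 := by
  rw [pmFullSlack_inr, pmVec_apply, if_neg]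
  exact mk_not_mem_liftPM (rowT_ends hn a).1 (rowT_ends hn a).2 M

/-! ### §3 The lifting step `K_n → K_{n+2}` (FGPRT Thm. 2.10 on `[T 0; Q S(K_n)]`) and the induction -/

/-- **The lifting step.** If every psd factorisation of Edmonds' slack matrix of `K_n` (`n ≥ 4` even) has size `≥ r`,
then every psd factorisation of that of `K_{n+2}` has size `≥ r + (2n − 1)`: the slack matrix of `K_{n+2}` contains
the bordered block matrix `[T 0; Q S(K_n)]` — `S(K_n)` on the face `x_{01} = 1` (lifted rows × lifted matchings), `T`
the triangular `(2n−1) × (2n−1)` block of §2 on (edges through `0` or `1`) × (columns `T(p,q)`), which vanish on the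
lifted matchings — and `rank_psd [T 0; Q R] ≥ rank_psd T + rank_psd R ≥ (2n − 1) + r` [FawziEtAl2015, Thm. 2.10 (p07) +
Ex. 2.11; GouveiaRobinsonThomas2013, Prop. 3.8 (p09): `2n − 1 = dim P_PM(K_{n+2}) − dim P_PM(K_n)` is the codimension
of the face]. [cite: FawziEtAl2015, Thm. 2.10 (p07); GouveiaRobinsonThomas2013, Prop. 3.8 (p09)] -/
theorem lift_step (hn : 4 ≤ n) (he : Even n) {r : ℕ} (hr : ∀ r', HasPsdFactorization (pmFullSlack n) r' → r ≤ r')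
    {k : ℕ} (hk : HasPsdFactorization (pmFullSlack (n + 2)) k) : r + (2 * n - 1) ≤ k := by
  classical
  let T : Fin (2 * n - 1) → Fin (2 * n - 1) → ℝ :=
    fun a b => pmFullSlack (n + 2) (Sum.inr (rowT hn a)) (colT hn he b).toPMatch
  let Q : (OddSet n ⊕ Edge n) → Fin (2 * n - 1) → ℝ :=
    fun j b => pmFullSlack (n + 2) (liftRow j) (colT hn he b).toPMatch
  have hblock : HasPsdFactorization
      (Matrix.fromBlocks (Matrix.of T) 0 (Matrix.of Q) (Matrix.of (pmFullSlack n))) k := by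
    have e : Matrix.fromBlocks (Matrix.of T) 0 (Matrix.of Q) (Matrix.of (pmFullSlack n)) =
        fun i j => pmFullSlack (n + 2) (Sum.elim (fun a => Sum.inr (rowT hn a)) liftRow i)
          (Sum.elim (fun b => (colT hn he b).toPMatch) liftPM j) := by
      ext (a | i) (b | M)
      · rfl
      · simp only [Matrix.fromBlocks_apply₁₂, Matrix.zero_apply, Sum.elim_inl, Sum.elim_inr]
        exact (rowT_liftPM hn a M).symm
      · rfl
      · simp only [Matrix.fromBlocks_apply₂₂, Matrix.of_apply, Sum.elim_inr]
        exact (pmFullSlack_lift i M).symm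
    rw [e]
    exact hk.submatrix _ _
  obtain ⟨k₁, k₂, hk12, hT, hR⟩ :=
    FawziEtAl2015_thm210_holds _ _ _ _ T Q (pmFullSlack n) k hblock
  have hdiag : ∀ a, T a a ≠ 0 := fun a => by
    show pmFullSlack (n + 2) (Sum.inr (rowT hn a)) (colT hn he a).toPMatch ≠ 0
    rw [pmFullSlack_inr, pmVec_apply, if_pos (rowT_mem_colT hn he a)]
    exact one_ne_zero
  have hoff : ∀ a b : Fin (2 * n - 1), a < b → T a b = 0 := fun a b hab => by
    show pmFullSlack (n + 2) (Sum.inr (rowT hn a)) (colT hn he b).toPMatch = 0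
    rw [pmFullSlack_inr, pmVec_apply, if_neg (rowT_not_mem_colT hn he hab)]
  have hT' : 2 * n - 1 ≤ k₁ := hT.card_le_of_triangular id id hdiag hoff
  have hR' : r ≤ k₂ := hr k₂ hR
  omega

/-- `C(n,2) ≥ n` for `n ≥ 3`. [folklore] -/
private theorem le_choose_two {n : ℕ} (h3 : 3 ≤ n) : n ≤ n.choose 2 := by
  rw [Nat.choose_two_right]
  apply (Nat.le_div_iff_mul_le two_pos).2
  obtain ⟨k, rfl⟩ : ∃ k, n = k + 3 := ⟨n - 3, by omega⟩
  rw [show k + 3 - 1 = k + 2 from rfl]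
  nlinarith

/-- **`rk_psd(S_Edmonds(K_{2m})) ≥ dim P_PM(K_{2m}) + 2 = C(2m,2) − 2m + 2` for every `m ≥ 5`** (induction from the kernel
base case `K_10`, `thirtySeven_le_of_hasPsdFactorization_pmFullSlack_ten`, along `lift_step`).
[cite: GouveiaRobinsonThomas2013, Prop. 3.2 (p07), Prop. 3.8 (p09); FawziEtAl2015, Thm. 2.10 (p07)] -/
theorem dim_add_two_le_of_hasPsdFactorization_two_mul {m : ℕ} (hm : 5 ≤ m) :
    ∀ r, HasPsdFactorization (pmFullSlack (2 * m)) r → (2 * m).choose 2 - 2 * m + 2 ≤ r := by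
  induction m, hm using Nat.le_induction with
  | base =>
    intro r hr
    have h := thirtySeven_le_of_hasPsdFactorization_pmFullSlack_ten hr
    have : (2 * 5).choose 2 - 2 * 5 + 2 = 37 := by decide
    omega
  | succ m hm ih =>
    intro r hr
    rw [show 2 * (m + 1) = 2 * m + 2 by ring] at hr
    have h := lift_step (n := 2 * m) (by omega) ⟨m, two_mul m⟩ ih hr
    have e1 : (2 * (m + 1)).choose 2 = (2 * m).choose 2 + (4 * m + 1) := by
      rw [Nat.choose_two_right, Nat.choose_two_right]
      obtain ⟨k, rfl⟩ : ∃ k, m = k + 1 := ⟨m - 1, by omega⟩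
      rw [show 2 * (k + 1 + 1) - 1 = 2 * k + 3 by omega, show 2 * (k + 1) - 1 = 2 * k + 1 by omega,
        show 2 * (k + 1 + 1) * (2 * k + 3) = 2 * ((k + 2) * (2 * k + 3)) by ring,
        show 2 * (k + 1) * (2 * k + 1) = 2 * ((k + 1) * (2 * k + 1)) by ring,
        Nat.mul_div_cancel_left _ two_pos, Nat.mul_div_cancel_left _ two_pos]
      ring
    have e2 := le_choose_two (n := 2 * m) (by omega)
    omega

/-- **`P_PM(K_n)` is not psd-minimal for even `n ≥ 10`**: `rk_psd(S_Edmonds(K_n)) ≥ C(n,2) − n + 2 = dim P_PM(K_n) + 2`,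
one more than the dimension bound of GRT Prop. 3.2 (attained for `n ≤ 8`). [cite: GouveiaRobinsonThomas2013, Prop. 3.2 (p07), Prop. 3.8 (p09), Cor. 4.2 (p10)] -/
theorem dim_add_two_le_of_hasPsdFactorization {N r : ℕ} (hN : Even N) (h10 : 10 ≤ N)
    (h : HasPsdFactorization (pmFullSlack N) r) : N.choose 2 - N + 2 ≤ r := by
  obtain ⟨m, rfl⟩ := hN
  rw [← two_mul] at h h10 ⊢
  exact dim_add_two_le_of_hasPsdFactorization_two_mul (by omega) r h

/-- The same as a non-existence: no psd factorisation of the dimension-bound size `C(n,2) − n + 1` for even `n ≥ 10`.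
[cite: GouveiaRobinsonThomas2013, Prop. 3.2 (p07), Prop. 3.8 (p09)] -/
theorem not_hasPsdFactorization_pmFullSlack_dim {N : ℕ} (hN : Even N) (h10 : 10 ≤ N) :
    ¬ HasPsdFactorization (pmFullSlack N) (N.choose 2 - N + 1) := fun h => by
  have := dim_add_two_le_of_hasPsdFactorization hN h10 h
  omega

/-- **`P_PM(K_n)` is psd-minimal iff `n ≤ 8`** (even `n ≥ 4`): Edmonds' slack matrix of `K_n` has a psd factorisation
of size `dim P_PM(K_n) + 1 = C(n,2) − n + 1` exactly when `n ∈ {4, 6, 8}` (`⇐`: the tree's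
`hasPsdFactorization_pmFullSlack_of_le_eight`, GRT Cor. 4.2, 2-level polytopes; `⇒`: this file).
[cite: GouveiaRobinsonThomas2013, Cor. 4.2 (p10), Prop. 3.2 (p07), Prop. 3.8 (p09)] -/
theorem hasPsdFactorization_pmFullSlack_dim_iff {N : ℕ} (hN : Even N) (h4 : 4 ≤ N) :
    HasPsdFactorization (pmFullSlack N) (N.choose 2 - N + 1) ↔ N ≤ 8 := by
  constructor
  · intro h
    by_contra h8
    exact not_hasPsdFactorization_pmFullSlack_dim hN (by obtain ⟨m, rfl⟩ := hN; omega) h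
  · exact fun h8 => hasPsdFactorization_pmFullSlack_of_le_eight hN h4 h8

end PsdMinimalIff

end Literature.Barriers.PneNP
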